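/-
Origin: expansion seat `planner-pub-hodgecm-mc-axioms-1-g14-0`, handover #W185 2026-08-20T15:53:55Z md5 d1e534244b75 (PKG ca8ae7cfa94e → d1e534244b75; 156 l.; MECHANICAL (iib-R) rewrite v3.1 of the PKG file as it stands (44 token edits; rules R1x1+RX[h₂']x43)) (`HOME/mc/pub-hodgecm-mc-axioms-1-g14/revendor/kit-r55/stage55/HodgeCM/Model/Sanity/DegenerateClosureR17A.lean`, md5 d1e534244b75, 156 lines);
landed by the gen-22 packager (p-g22) in gate run 55 REPLACES the earlier landed copy of `HodgeCM/Model/Sanity/DegenerateClosureR17A.lean` (seat copy carried the packager Origin header of an earlier run (stripped)).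
-/
/-
Origin: SANITY lane `planner-pub-hodgecm-mc-sanity-1-g7-0` (unit pub-hodgecm-mc-sanity-1-g7, gen 7 of mc-sanity-1,
node SAN-17; rev. 2), 2026-08-19.  NEW additive KERNEL leaf `HodgeCM/Model/Sanity/DegenerateClosureR17A.lean` over the
RUN-35 (v2 «level-free ιinf» joint cut) modules `HodgeCM.Model.E2InstanceR17A` (glue-1-g4 #332 ″, imports `E2InstanceR15A` ″
M14 + theta-3-g4 `ThetaHolContinuity`), `HodgeCM.Model.Sanity.DegenerateClosure` (M13 ″) and the light SAN-17a leaf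
`HodgeCM.Model.Sanity.ThetaAdelicSideDegenerateLF` (`isLFAction_degS`, `isThetaArchContinuous_degS`; rev. 2 = rev. 1
3948c8b13624 with those two lemmas MOVED OUT to that leaf, nothing else changed).  Imported by nothing.
KERNEL: 0 records, 0 `Prop` definitions, 0 hypotheses minted, nothing cited, no instances.
Expected `#print axioms`: ⊆ {propext, Classical.choice, Quot.sound}.
-/
import Summits.HodgeConjecture.HodgeCM.Model.E2InstanceR17A
import Summits.HodgeConjecture.HodgeCM.Model.Sanity.DegenerateClosure
import Summits.HodgeConjecture.HodgeCM.Model.Sanity.ThetaAdelicSideDegenerateLF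

/-!
# SAN-17 — the DEGENERATE CLOSURE of E R15A″ / R17A″ (the binders traded since R13: `hol` ↦ `hT`+`hpd`+`hk` ↦ `hLF`+`hpd`+`hk`)

MODEL-CONSTRUCTION sub-cell, SANITY lane (unit `pub-hodgecm-mc-sanity-1-g7`, node SAN-17).  KERNEL only; census leaf.

SAN-15 (`Sanity/DegenerateClosure`) closed E R10″ / R13″ over the degenerate inhabitants `S := degS`, `W := zeroSK ∘ W`
modulo the single DATA binder `CdegS` (empty: SAN-15b `isEmpty_CdegS`).  Revisions 15A and 17A (RUN 35) replace R13's
`hol` by three binders ABOUT the data: `hT` (continuity of the archimedean theta functionals of `S`), resp. in R17A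
`hLF : ∀ V c k, ((S V c).P k).IsLFAction` (every Weil operator `ω(g)` of the pair data is LF-continuous), plus
`hpd` / `hk` (properties OF the term `C V c …`).  This file records what they cost over the degenerate data:

* (SAN-17a leaf `Sanity/ThetaAdelicSideDegenerateLF`, imported) `isLFAction_degS` — over `degS` the pair action is
  `ω := 1`, LF-continuous (`isLFContinuous_id`): `hLF` is FREE over `degS`; `isThetaArchContinuous_degS` — hence `hT`
  is free over `degS` too (theta-3-g4 `WeilPairData.isThetaArchContinuous_of_isLFContinuous`).
* `perL_r15Acore_degS` / `perL_r17Acore_degS` — E R15A″ / R17A″ at `S := degS`, `W := zeroSK ∘ W` close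
  `(picardCMUniverse …).PerL` from `hHR h hA W μ hBetti h31` and the ONE binder `CdegS`; `hpd` / `hk` are discharged
  by `isEmptyElim` on the empty fibre of `C` (SAN-10b `isEmpty_C_fibre_degS`), every other binder by the SAN-11 / SAN-12
  kernel theorems exactly as in SAN-15.
* `perL_r17Acore_of_noGoodSextic` — so R17A, like R10/R13, closes from toys EXACTLY modulo the vacuity residual
  `NoGoodSextic` (refuted in kernel by prl1-g15's good sextic witness: SAN-15b `not_noGoodSextic`).

READING (census, MODEL-N ±0; nothing here is a defect claim): the R13 → R15A → R17A trades move (H1) towards print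
without changing the degenerate census — over degenerate data every binder of E except `C` is free and `C` is the
gatekeeper; the new binders `hT` / `hLF` / `hpd` / `hk` carry no content that the toys could fake past `C`.
-/

set_option autoImplicit false

noncomputable section

namespace HodgeCM
namespace Model
namespace Sanity

open HodgeCM.Universe (SideData ThetaModel AdelicThetaCore AdelicTorusCore)
open HodgeCM.PerL34 HodgeCM.PerL34.ArchC
open Literature.AlgebraicGeometry.HodgeTheory Literature.NumberTheory.Automorphic.PicardCM
open Literature.NumberTheory.Transcendental (Arapura2012_Cor_15_4_6)
open Literature.AlgebraicGeometry.ShimuraVarieties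
open HodgeCM.Model.ThetaSpace
open HodgeCM.Model.SupplyResidual

variable (hHD : exists_isReal_hodgeModel) (hI : hodgePQ_independent_of_hodgeModel)
  (h₁ : BallQuotientUniformised)  (h₃ : CMAbelianVarietyRealised)

/-- **E R15A″ over the degenerate data closes PerL modulo the single binder `C`** — `hT` by
`isThetaArchContinuous_degS`, `hpd` / `hk` by the emptiness of the fibre of `C` over `degS` (SAN-10b), the rest as in
SAN-15 `perL_r13core_degS`. -/
theorem perL_r15Acore_degS (hHR : BettiUniverse.HodgeRiemann20) (h : Bool) (hA : Arapura2012_Cor_15_4_6)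
    (W : ∀ {L : CMField} {ι₁ : L →+* ℂ} (V : HermSpace3 L ι₁) (c : SeesawCtx L), WmInput V c.D)
    (μ : ∀ {L : CMField}, SeesawCtx L → Fin 4 → NumberField.InfinitePlace L → ℤ)
    (hBetti : ∀ {L : CMField} {ι₁ : L →+* ℂ} (V : HermSpace3 L ι₁), EmbBettiSide hHD hI h₁ h₃ V)
    (h31 : (picardCMUniverse hHD hI h₁ h₃).Fact_cmInflation)
    (C : CdegS hHD hI h₁ h₃ h hA W μ) :
    (picardCMUniverse hHD hI h₁ h₃).PerL := by
  refine perL_picardCM_r15Acore hHD hI h₁ h₃ hHR h hA (fun V c => (W V c).zeroSK) degS μ hBetti h31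
    ?_ C ?_ ?_ ?_ ?_ ?_ ?_ ?_
  · -- `hLiu` — SAN-11 `hLiu_degS`
    intro L ι₁ V c hc hK i Γ
    exact hLiu_degS hHD hI h₁ h₃ h (embOf hHD hI h₁ h₃) (coverOf hHD hI h₁ h₃ hA)
      (wmOfInput fun V c => (W V c).zeroSK) (d12Of μ) (d34Of μ) V c hc hK i Γ
  · -- `hT` — free over `degS`
    intro L ι₁ V c k N
    exact isThetaArchContinuous_degS V c k N
  · -- `hpd` — the fibre of `C` over `degS` is empty (SAN-10b)
    intro L ι₁ V c hV hc h6 k hk N hN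
    exact ((isEmpty_C_fibre_degS hHD hI h₁ h₃ V c hV).false (C V c hV hc h6)).elim
  · -- `hk` — idem
    intro L ι₁ V c hV hc h6 k hk N hN
    exact ((isEmpty_C_fibre_degS hHD hI h₁ h₃ V c hV).false (C V c hV hc h6)).elim
  · -- `gen12` — SAN-12 `gen12_degS'`
    intro L ι₁ V c
    exact gen12_degS' hHD hI h₁ h₃ h (embOf hHD hI h₁ h₃) (coverOf hHD hI h₁ h₃ hA)
      (fun V c => (W V c).zeroSK) μ V c
  · -- `real34` — SAN-12 `real34_zeroSK`
    intro L ι₁ V c _ _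
    exact real34_zeroSK (embOf hHD hI h₁ h₃) (coverOf hHD hI h₁ h₃ hA) W _ h (d12Of μ) (d34Of μ) V c
  · -- `hyp12` — SAN-12 `hyp12_zeroSK`
    intro L ι₁ V c _ _
    exact hyp12_zeroSK (embOf hHD hI h₁ h₃) (coverOf hHD hI h₁ h₃ hA) W _ h _ _ _ V c
  · -- `hyp34` — SAN-12 `hyp34_zeroSK`
    intro L ι₁ V c _ _
    exact hyp34_zeroSK (embOf hHD hI h₁ h₃) (coverOf hHD hI h₁ h₃ hA) W _ h _ _ _ V c

/-- **E R17A″ over the degenerate data closes PerL modulo the single binder `C`** — `hLF` by `isLFAction_degS`,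
everything else as in `perL_r15Acore_degS`. -/
theorem perL_r17Acore_degS (hHR : BettiUniverse.HodgeRiemann20) (h : Bool) (hA : Arapura2012_Cor_15_4_6)
    (W : ∀ {L : CMField} {ι₁ : L →+* ℂ} (V : HermSpace3 L ι₁) (c : SeesawCtx L), WmInput V c.D)
    (μ : ∀ {L : CMField}, SeesawCtx L → Fin 4 → NumberField.InfinitePlace L → ℤ)
    (hBetti : ∀ {L : CMField} {ι₁ : L →+* ℂ} (V : HermSpace3 L ι₁), EmbBettiSide hHD hI h₁ h₃ V)
    (h31 : (picardCMUniverse hHD hI h₁ h₃).Fact_cmInflation)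
    (C : CdegS hHD hI h₁ h₃ h hA W μ) :
    (picardCMUniverse hHD hI h₁ h₃).PerL := by
  refine perL_picardCM_r17Acore hHD hI h₁ h₃ hHR h hA (fun V c => (W V c).zeroSK) degS μ hBetti h31
    ?_ C ?_ ?_ ?_ ?_ ?_ ?_ ?_
  · -- `hLiu` — SAN-11 `hLiu_degS`
    intro L ι₁ V c hc hK i Γ
    exact hLiu_degS hHD hI h₁ h₃ h (embOf hHD hI h₁ h₃) (coverOf hHD hI h₁ h₃ hA)
      (wmOfInput fun V c => (W V c).zeroSK) (d12Of μ) (d34Of μ) V c hc hK i Γ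
  · -- `hLF` — free over `degS`
    intro L ι₁ V c k
    exact isLFAction_degS V c k
  · -- `hpd` — the fibre of `C` over `degS` is empty (SAN-10b)
    intro L ι₁ V c hV hc h6 k hk N hN
    exact ((isEmpty_C_fibre_degS hHD hI h₁ h₃ V c hV).false (C V c hV hc h6)).elim
  · -- `hk` — idem
    intro L ι₁ V c hV hc h6 k hk N hN
    exact ((isEmpty_C_fibre_degS hHD hI h₁ h₃ V c hV).false (C V c hV hc h6)).elim
  · -- `gen12` — SAN-12 `gen12_degS'`
    intro L ι₁ V c
    exact gen12_degS' hHD hI h₁ h₃ h (embOf hHD hI h₁ h₃) (coverOf hHD hI h₁ h₃ hA)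
      (fun V c => (W V c).zeroSK) μ V c
  · -- `real34` — SAN-12 `real34_zeroSK`
    intro L ι₁ V c _ _
    exact real34_zeroSK (embOf hHD hI h₁ h₃) (coverOf hHD hI h₁ h₃ hA) W _ h (d12Of μ) (d34Of μ) V c
  · -- `hyp12` — SAN-12 `hyp12_zeroSK`
    intro L ι₁ V c _ _
    exact hyp12_zeroSK (embOf hHD hI h₁ h₃) (coverOf hHD hI h₁ h₃ hA) W _ h _ _ _ V c
  · -- `hyp34` — SAN-12 `hyp34_zeroSK`
    intro L ι₁ V c _ _
    exact hyp34_zeroSK (embOf hHD hI h₁ h₃) (coverOf hHD hI h₁ h₃ hA) W _ h _ _ _ V c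

/-- **E R17A closes from the degenerate data EXACTLY modulo the vacuity residual `NoGoodSextic`** (cf. SAN-15
`perL_r10core_of_noGoodSextic`; the residual is refuted by SAN-15b `not_noGoodSextic`). -/
theorem perL_r17Acore_of_noGoodSextic (hHR : BettiUniverse.HodgeRiemann20) (h : Bool) (hA : Arapura2012_Cor_15_4_6)
    (W : ∀ {L : CMField} {ι₁ : L →+* ℂ} (V : HermSpace3 L ι₁) (c : SeesawCtx L), WmInput V c.D)
    (μ : ∀ {L : CMField}, SeesawCtx L → Fin 4 → NumberField.InfinitePlace L → ℤ)
    (hBetti : ∀ {L : CMField} {ι₁ : L →+* ℂ} (V : HermSpace3 L ι₁), EmbBettiSide hHD hI h₁ h₃ V)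
    (h31 : (picardCMUniverse hHD hI h₁ h₃).Fact_cmInflation)
    (hno : NoGoodSextic hHD hI h₁ h₃ h hA W μ) :
    (picardCMUniverse hHD hI h₁ h₃).PerL :=
  perL_r17Acore_degS hHD hI h₁ h₃ hHR h hA W μ hBetti h31 fun V c hV hc h6 => (hno V c hV hc h6).elim

end Sanity
end Model
end HodgeCM

end
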